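import Summits.Ventures.AbcSig.Rows.TemplateAB
import Summits.Ventures.AbcSig.Levels.N614
import Summits.Ventures.AbcSig.Levels.N2456

/-!
# Venture AbcSig — ROW `C2aL307A45AB`: `307^m·xⁿ + 2^a·yⁿ = z²` (SECOND coefficient distribution of the cell; the distribution `xⁿ + 2^a·307^m·yⁿ = z²` is `Rows/C2aL307A45.lean`), class `a 45` (GENERATED by plean/leanrow.py)

HONEST FRAMING. A row of a COMPUTATION cell (`pub-abcsig`); a CONDITIONAL theorem, no claim on ABC or any summit.
Hypotheses: `BS04Package` (CITED), `DataComplete` at levels [614, 2456] (COMPUTED, two-engine certified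
level files), and the listed per-orbit exclusions `hX_…` (CITED — e.g. the cell's M6 Eisenstein certificates; the
row's R5 cell names each). Everything else is kernel-checked (`Rows/TemplateAB.lean`, `Levels/N….lean` — the SAME level files as the first distribution). Exponent
range: prime `n ≥ 11`, `n ≠ 307`; `B = 2^a 307^m` with `a, m < n` (n-th-power free).
Row of record:  (sha256 ; SIGNED 2026-08-22T13:21:45Z by referee (ref-g9)); its R0: THEOREM (uses CITED arithmetic facts) for all primes n >= 11 with n coprime to 4912 — class: ROW REVISION rev. 2 (lead 12:03:41Z/12:16:08Z protocol; rev. 1 sign. Exponents left open by the row of record are excluded here via ; kernel-sieve residuals the row of record closes by a cell module (M6 Eisenstein / M4 Kraus certificates) appear as CITED hypotheses .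
-/

namespace Summit.Ventures.AbcSig

/-- Row `C2aL307A45AB`: second coefficient distribution `307^m·xⁿ + 2^a·yⁿ = z²` (see module docstring). -/
theorem row_C2aL307A45AB (M : NewformModel) (hP : M.BS04Package)
    (hD614 : M.DataComplete 614 level614Orbits) (hD2456 : M.DataComplete 2456 level2456Orbits)
    (n : ℕ) (hn : n.Prime) (hmin : 11 ≤ n) (hnℓ : n ≠ 307) (a m : ℕ) (ha : a = 4 ∨ a = 5) (hm : 1 ≤ m) (han : a < n) (hmn : m < n)
    (hX_orbit_614_6 : n ∈ ([7, 11] : List ℕ) → M.Excludes 614 orbit_614_6 (famAB (307 ^ m) (2 ^ a) n (fun _ _ => True)))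
    (hX_orbit_2456_3 : n ∈ ([13] : List ℕ) → M.Excludes 2456 orbit_2456_3 (famAB (307 ^ m) (2 ^ a) n (fun _ _ => True)))
    (hX_orbit_2456_4 : n ∈ ([7, 17] : List ℕ) → M.Excludes 2456 orbit_2456_4 (famAB (307 ^ m) (2 ^ a) n (fun _ _ => True)))
    (x y z : ℤ) (hxy1 : x * y ≠ 1) (hxy2 : x * y ≠ -1) : ¬ IsPrimitiveSolution (307 ^ m) (2 ^ a) 1 n x y z := by
  have hℓ : Nat.Prime 307 := by norm_num
  have h7 : 7 ≤ n := by omega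
  have hS614 :=
    (level614_sieve n hn h7 (fun o => M.Excludes 614 o (famAB (307 ^ m) (2 ^ a) n (fun _ _ => True))) (fun h => absurd h (by simp only [List.mem_cons, List.not_mem_nil, or_false]; omega)) (fun h => absurd h (by simp only [List.mem_cons, List.not_mem_nil, or_false]; omega)) (fun h => absurd h (by simp only [List.mem_cons, List.not_mem_nil, or_false]; omega)) hX_orbit_614_6)
  have hS2456 :=
    (level2456_sieve n hn h7 (fun o => M.Excludes 2456 o (famAB (307 ^ m) (2 ^ a) n (fun _ _ => True))) (fun h => absurd h (by simp only [List.mem_cons, List.not_mem_nil, or_false]; omega)) (fun h => absurd h (by simp only [List.mem_cons, List.not_mem_nil, or_false]; omega)) hX_orbit_2456_3 hX_orbit_2456_4)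
  exact rowC2aAB_a45 307 hℓ (by norm_num) M hP n hn h7 hnℓ hD2456 hD614 a m ha hm han hmn
    hS2456
    hS614 x y z hxy1 hxy2

end Summit.Ventures.AbcSig
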